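import Literature.MathematicalPhysics.QuantumFieldTheory.Balaban1983to89.B9Eq3147ProjectionOps
import Literature.MathematicalPhysics.QuantumFieldTheory.Balaban1983to89.B9Eq311L2Pairing
import Literature.MathematicalPhysics.QuantumFieldTheory.Balaban1983to89.B9Eq319Onto

/-!
# `Balaban1983to89.B11Eq110GreenLattice` — T. Bałaban, *The variational problem and background fields in renormalization group method
# for lattice gauge theories*, Commun. Math. Phys. **102** (1985) 277–309 [Balaban1985Variational] (110)–(111) p. 294, (45) p. 285, (103) p. 293,
# with [Balaban1985BackgroundPropagators] (3.3)/(3.8) pp. 390–392, (3.19) p. 393, (3.147)/(3.153) pp. 425–426: `Δ_{1,a} = Δ₁ + DRD* + aQ*Q`,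
# `G₁`, `H₁ = G₁Q*(QG₁Q*)⁻¹` and `𝔊 = G₁𝔓*` ON BAŁABAN'S LATTICE `L²` SPACES — the abstract constructions of `B11Eq110GreenInverse` /
# `B9Eq3147ProjectionOps` INSTANTIATED with `D := (3.3)`, `D* := (3.8) = D†`, `Q* := Q†` on `BondL2`/`SiteL2` of `B9Eq311L2Pairing`

statement-level skeleton of published theorems with citation tags; proofs where landed; nothing here is a claim
about the Yang–Mills mass gap

PDF held: `paper:balaban1985-cmp102-variational-background`, `paper:balaban1985-cmp99-background-propagators`; the printed texts are quoted
verbatim in the headers of `B11Eq110GreenInverse`, `B9Eq3147ProjectionOps`, `B9Eq311L2Pairing` (this seat, 2026-08-21).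

WHY THIS FILE (cell context).  Last brick of the gen-76 owner line (pub-balaban NE9 letter map (L2)/(L6)): put the pieces together on the
CONCRETE carriers.  `E := BondL2 d Pd c₀ W` (𝔤-valued bond functions of the periodic lattice with the `η^d`-weighted `L²` product), `S :=
SiteL2` (gauge parameters), `D := covDerivL2 c₀ c R` (3.3), `D* := covDivL2 c₀ c S` (3.8) — which IS `LinearMap.adjoint D`
(`adjoint_covDerivL2`) —, `Q* := LinearMap.adjoint Q`; the Hessian `Δ₁`, the restriction `R`, the averaging `Q : BondL2 → F` and `a` stay DATA.
Then `Δ_{1,a}` is a genuine SYMMETRIC operator when `Δ₁`, `R` are (`laplaceALattice_isSymmetric`), and `H₁`, `𝔊` are linear/continuous-linear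
maps of these spaces determined by the data and two displayed facts (positivity of `Δ_{1,a}` = [B9] Thm 3.11; `Q` onto = [B9] (3.19)), with
(45) `Q(H₁b) = b` hypothesis-free and [B11] p. 294's `Q𝔊 = 0`, `RD*𝔊 = 0` from the displayed identities (3.124).

WHAT IS DEFINED AND PROVED (sorry-free; no `Prop` placeholder; no inequality of the paper).
* §1 `laplaceALattice c R S Δ₁ Rr Q a := laplaceA Δ₁ (covDerivL2 …) Rr (covDivL2 …) Q Q† a`; **`laplaceALattice_eq_adjoint_form`**
  (`= Δ₁ + D ∘ R ∘ D† + Q† ∘ (aQ)` — the `D*` slot IS the adjoint); **`laplaceALattice_isSymmetric`**.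
* §2 `hadj_adjoint` (the «hadj» of the abstract files is a theorem here), `adjoint_Q_injective` (⇐ `Q` onto, by `B9Eq319Onto`);
  **`H1Lattice`** with **`Q_H1Lattice`** ((45)); **`frakGLattice`** with `Q_frakGLattice`, `RDstar_frakGLattice` ([B11] p. 294); `frakGLatticeCLM`,
  `H1LatticeCLM`.

MODEL / DECLARED READINGS.  (M1) as `B9Eq311L2Pairing` (uniform weight `c₀ = η^d`, real inner-product fibre `W` = hermitian matrices, transporter
data `R`/`S` mutually adjoint = unitarity of `R(U(b))`), block-field space `F` abstract (its `(L^jη)^d`-weighted `L²` structure is `WL2` too;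
`Q` = the averaging (3.19) is DATA — `B9Eq319Onto.avgQLin` is its abstract shape).  (M2) DISPLAYED, never asserted: `hpos` ([B9] Thm 3.11),
`hQ` (`Q` onto), (3.124) / «RD*G₁DR = R».  (M3) NOT HERE: `Δ₁` as the Wilson Hessian (its principal part `D*D` is `covLapPrincipalL2`; the
curvature part `Δ′` of (3.10) is not typed), `R`, `a_j`, the ℝ/L² → ℂ/sup-norm transfer to `B11Eq115Space`.
HONEST SCOPE.  Instantiation/bookkeeping of the cell's own constructions on printed carriers; no estimate of the paper; NOT summit progress (cell
pub-balaban: NE9 NOT PRINTED / NOT PROVED; spine PROVED 0/9).  Filed by the pub-balaban NE9 BINDER-row owner lineage `b2b-balaban-t4-ne9-p1`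
(gen 76); a NEW file importing `B9Eq3147ProjectionOps`, `B9Eq311L2Pairing`, `B9Eq319Onto`; nothing of lit-balaban's is modified.  Net new
unproved facts: 0.
-/

noncomputable section

open scoped InnerProductSpace

namespace Literature.MathematicalPhysics.QuantumFieldTheory.Balaban1983to89.B11Eq110GreenLattice

open B9SectCLatticeCarrier (Bond)
open B4Sect5Torus (TSite)
open B11Eq127EulerLagrange (laplaceA)
open B9Eq311L2Pairing (SiteL2 BondL2 covDerivL2 covDivL2 adjoint_covDerivL2)
open B11Eq110GreenInverse (G1 Kinv H1 laplaceA_G1 hK_holds Q_H1)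
open B9Eq3147ProjectionOps (frakP frakG Q_frakG RDstar_frakG frakG_eq_G1_comp_frakPstar)

variable {d : ℕ} {Pd : Fin d → ℕ} {W : Type*} [NormedAddCommGroup W] [InnerProductSpace ℝ W] [FiniteDimensional ℝ W] {c₀ : ℝ} [Fact (0 < c₀)]
  {F : Type*} [NormedAddCommGroup F] [InnerProductSpace ℝ F] [FiniteDimensional ℝ F]

/-! ## §1 `Δ_{1,a} = Δ₁ + DRD* + aQ*Q` ON THE LATTICE `L²` SPACES, with `D` = (3.3), `D*` = (3.8), `Q*` = the Hilbert adjoint of `Q` -/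

/-- **`Δ_{1,a}` on Bałaban's lattice `L²` spaces**: lit-balaban's `laplaceA` with the configuration space `E := BondL2` (𝔤-valued bond functions,
`η^d`-weighted `L²`), the gauge-parameter space `S := SiteL2`, `D := covDerivL2 c₀ c R` ((3.3)), `D* := covDivL2 c₀ c S` ((3.8)), `Q* :=
LinearMap.adjoint Q`; the Hessian `Δ₁`, the restriction `R`, the averaging `Q` and the constant `a` remain DATA.
[cite: Balaban1985Variational, (110) p.294, p.293] -/
def laplaceALattice (c : ℝ) (R S : Bond d Pd → W →ₗ[ℝ] W) (Δ₁ : BondL2 d Pd c₀ W →ₗ[ℝ] BondL2 d Pd c₀ W)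
    (Rr : SiteL2 d Pd c₀ W →ₗ[ℝ] SiteL2 d Pd c₀ W) (Q : BondL2 d Pd c₀ W →ₗ[ℝ] F) (a : ℝ) :
    BondL2 d Pd c₀ W →ₗ[ℝ] BondL2 d Pd c₀ W :=
  laplaceA Δ₁ (covDerivL2 c₀ c R) Rr (covDivL2 c₀ c S) Q (LinearMap.adjoint Q) a

variable {c : ℝ} {R S : Bond d Pd → W →ₗ[ℝ] W} {Δ₁ : BondL2 d Pd c₀ W →ₗ[ℝ] BondL2 d Pd c₀ W}
  {Rr : SiteL2 d Pd c₀ W →ₗ[ℝ] SiteL2 d Pd c₀ W} {Q : BondL2 d Pd c₀ W →ₗ[ℝ] F} {a : ℝ}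

/-- **In the lattice instance the `D*` slot IS the Hilbert adjoint of the `D` slot** (for mutually adjoint transporter data):
`Δ_{1,a} = Δ₁ + D ∘ R ∘ D† + Q† ∘ (aQ)`. [cite: Balaban1985BackgroundPropagators, (3.8) p.392; Balaban1985Variational, p.293] -/
theorem laplaceALattice_eq_adjoint_form (hRS : ∀ (b : Bond d Pd) (v u : W), ⟪u, R b v⟫_ℝ = ⟪S b u, v⟫_ℝ) :
    laplaceALattice c R S Δ₁ Rr Q a =
      Δ₁ + covDerivL2 c₀ c R ∘ₗ Rr ∘ₗ LinearMap.adjoint (covDerivL2 c₀ c R) + LinearMap.adjoint Q ∘ₗ (a • Q) := by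
  rw [laplaceALattice, laplaceA, adjoint_covDerivL2 c R S hRS]

/-- **`Δ_{1,a}` is SYMMETRIC when `Δ₁` and `R` are** (transporters mutually adjoint): the «scalar product defined by the operator Δ₁ + D*RD + aQ*Q»
of [B11] p. 293 is a genuine symmetric form on `BondL2`. [cite: Balaban1985Variational, p.293] -/
theorem laplaceALattice_isSymmetric (hRS : ∀ (b : Bond d Pd) (v u : W), ⟪u, R b v⟫_ℝ = ⟪S b u, v⟫_ℝ) (hΔ : Δ₁.IsSymmetric)
    (hR : Rr.IsSymmetric) : (laplaceALattice c R S Δ₁ Rr Q a).IsSymmetric := by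
  rw [laplaceALattice_eq_adjoint_form hRS]
  intro x y
  simp only [LinearMap.add_apply, LinearMap.comp_apply, LinearMap.smul_apply, inner_add_left, inner_add_right]
  refine congrArg₂ (· + ·) (congrArg₂ (· + ·) (hΔ x y) ?_) ?_
  · rw [← LinearMap.adjoint_inner_right, hR, LinearMap.adjoint_inner_left]
  · rw [LinearMap.adjoint_inner_left, inner_smul_left, LinearMap.adjoint_inner_right, inner_smul_right]
    simp

/-! ## §2 `G₁`, `H₁`, `𝔊` on the lattice `L²` spaces: the B2′ letters (L6)/(L2) as objects modulo the data `Δ₁, R, Q, a` -/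

variable (hRS : ∀ (b : Bond d Pd) (v u : W), ⟪u, R b v⟫_ℝ = ⟪S b u, v⟫_ℝ)
  (hpos : ∀ x : BondL2 d Pd c₀ W, x ≠ 0 → 0 < ⟪x, laplaceALattice c R S Δ₁ Rr Q a x⟫_ℝ) (hQ : Function.Surjective Q)

/-- `⟨Qx, y⟩ = ⟨x, Q†y⟩` — the «hadj» of the abstract files, here a THEOREM (`LinearMap.adjoint`). [cite: Balaban1985BackgroundPropagators, (3.19) p.393] -/
theorem hadj_adjoint (x : BondL2 d Pd c₀ W) (y : F) : ⟪Q x, y⟫_ℝ = ⟪x, LinearMap.adjoint Q y⟫_ℝ :=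
  (LinearMap.adjoint_inner_right Q x y).symm

/-- `Q†` is injective because `Q` is onto ([B9] (3.19) «Q′ onto», `B9Eq319Onto.injective_of_adjoint_of_surjective`).
[cite: Balaban1985BackgroundPropagators, (3.19) p.393; Balaban1984PropagatorsI, p.25] -/
theorem adjoint_Q_injective (hQ : Function.Surjective Q) : Function.Injective (LinearMap.adjoint Q) :=
  B9Eq319Onto.injective_of_adjoint_of_surjective Q (LinearMap.adjoint Q) (hadj_adjoint) hQ

/-- **`H₁` ON THE LATTICE `L²` SPACES** — [B11] (45)/(103)'s operator as a linear map `F →ₗ BondL2` determined by the DATA `Δ₁, R, Q, a`, the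
transporters, the displayed positivity of `Δ_{1,a}` ([B9] Thm 3.11) and `Q` onto ([B9] (3.19)). [cite: Balaban1985Variational, (45) p.285, (103) p.293] -/
def H1Lattice : F →ₗ[ℝ] BondL2 d Pd c₀ W :=
  H1 (Δ := Δ₁) (D := covDerivL2 c₀ c R) (R := Rr) (Dstar := covDivL2 c₀ c S) (Q := Q) (Qadj := LinearMap.adjoint Q) (a := a)
    hpos hadj_adjoint (adjoint_Q_injective hQ)

/-- **(45) on the lattice: `Q(H₁b) = b`**, hypothesis-free given the data. [cite: Balaban1985Variational, (45) p.285] -/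
theorem Q_H1Lattice (b : F) : Q (H1Lattice hpos hQ b) = b := Q_H1 hpos hadj_adjoint (adjoint_Q_injective hQ) b

/-- **`𝔊` ON THE LATTICE `L²` SPACES** — [B11] (110)–(111)'s operator ([B9] (3.153)) as a linear map of `BondL2`.
[cite: Balaban1985Variational, (110)–(111) p.294; Balaban1985BackgroundPropagators, (3.153) p.426] -/
def frakGLattice : BondL2 d Pd c₀ W →ₗ[ℝ] BondL2 d Pd c₀ W :=
  frakG (Δ := Δ₁) (D := covDerivL2 c₀ c R) (R := Rr) (Dstar := covDivL2 c₀ c S) (Q := Q) (Qadj := LinearMap.adjoint Q) (a := a)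
    hpos hadj_adjoint (adjoint_Q_injective hQ)

/-- **`Q𝔊 = 0` on the lattice** ([B11] p. 294), from the displayed identity (3.124) `QG₁DR = 0`. [cite: Balaban1985Variational, p.294] -/
theorem Q_frakGLattice
    (h124 : Q ∘ₗ G1 Δ₁ (covDerivL2 c₀ c R) Rr (covDivL2 c₀ c S) Q (LinearMap.adjoint Q) a hpos ∘ₗ covDerivL2 c₀ c R ∘ₗ Rr = 0)
    (x : BondL2 d Pd c₀ W) : Q (frakGLattice hpos hQ x) = 0 :=
  Q_frakG hpos hadj_adjoint (adjoint_Q_injective hQ) h124 x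

/-- **`RD*𝔊 = 0` on the lattice** ([B11] p. 294), with `D*` the GENUINE adjoint `D†` of (3.3), from the displayed `RD*G₁Q* = 0` and «`RD*G₁DR = R`».
[cite: Balaban1985Variational, p.294] -/
theorem RDstar_frakGLattice
    (h124' : Rr ∘ₗ covDivL2 c₀ c S ∘ₗ G1 Δ₁ (covDerivL2 c₀ c R) Rr (covDivL2 c₀ c S) Q (LinearMap.adjoint Q) a hpos ∘ₗ LinearMap.adjoint Q = 0)
    (hR : Rr ∘ₗ covDivL2 c₀ c S ∘ₗ G1 Δ₁ (covDerivL2 c₀ c R) Rr (covDivL2 c₀ c S) Q (LinearMap.adjoint Q) a hpos ∘ₗ covDerivL2 c₀ c R ∘ₗ Rr = Rr)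
    (x : BondL2 d Pd c₀ W) : Rr (covDivL2 c₀ c S (frakGLattice hpos hQ x)) = 0 :=
  RDstar_frakG hpos hadj_adjoint (adjoint_Q_injective hQ) h124' hR x

/-- `𝔊` and `H₁` on the lattice as CONTINUOUS linear maps (finite dimension) — the shape in which `B11Eq174Chart.Regime` takes `𝒢` and the chart
takes `H₁`, up to the ℝ/L² → ℂ/sup-norm transfer to `B11Eq115Space` (same underlying function space; not done here).
[cite: Balaban1985Variational, (117) p.295, (174) p.305] -/
def frakGLatticeCLM : BondL2 d Pd c₀ W →L[ℝ] BondL2 d Pd c₀ W := LinearMap.toContinuousLinearMap (frakGLattice hpos hQ)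

/-- `H₁` on the lattice as a continuous linear map. [cite: Balaban1985Variational, (103) p.293] -/
def H1LatticeCLM : F →L[ℝ] BondL2 d Pd c₀ W := LinearMap.toContinuousLinearMap (H1Lattice hpos hQ)

end Literature.MathematicalPhysics.QuantumFieldTheory.Balaban1983to89.B11Eq110GreenLattice

end
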